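import Literature.NumberTheory.EllipticCurves.FormalGroupPadicIntEndomorphisms
import Literature.NumberTheory.GaloisRepresentations.LubinTate
import Mathlib.NumberTheory.Padics.RingHoms
import Mathlib.NumberTheory.Padics.Hensel
import HarnessLib

/-!
# The formal group of an ORDINARY elliptic curve over `ℤ_p` is a Lubin–Tate group:
# `[π] ∈ 𝔉_π`, `π = p/(unit root of Frobenius)` — de Shalit II.1.10 at a prime of degree one (proofs only)

Topic `NumberTheory/EllipticCurves` (theorems only; no definition, no named fact, no instance).
Let `V/ℤ_p` be a Weierstrass equation with elliptic generic fibre `W = V ⊗ ℚ_p` and elliptic special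
fibre `Ṽ = V ⊗ 𝔽_p`, and `a = p + 1 − #Ṽ(𝔽_p)` (`HasseManin.tr Ṽ`).  Suppose `T² − aT + p` has a root
`ϖ ∈ ℤ_pˣ` (this happens iff `Ṽ` is ORDINARY, `p ∤ a`: `exists_isUnit_sq_sub_mul_add_eq_zero`, Hensel)
and put `π := a − ϖ`, so that `πϖ = p` and `π` is a uniformiser of `ℤ_p`.  With `[c] = exp_W(c·log_W)`
(`c ∈ ℤ_p`, an endomorphism of `V̂` with `p`-integral coefficients — `FormalGroupPadicIntEndomorphisms`):

* §1 ★★ `map_toZMod_eq_X_pow_of_root` — **`[π] ≡ zᵖ (mod p)`, EXACTLY**: in `End(Ṽ̂)` the `p`-power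
  Frobenius `φ = zᵖ` satisfies Manin's `φ² − [a]φ + [p] = 0` (the tree's `frob_relation_laurentPt`,
  every `p`, `p = 2` included), while `[a]˜ = [π]˜ ⊕ [ϖ]˜` and `[p]˜ = [π]˜ ∘ [ϖ]˜`; hence
  `[π]˜ ∘ h = φ ∘ h` for `h = φ ⊖ [ϖ]˜` (read on the formal point `P(σ) ∈ Ṽ(𝔽_p⸨z⸩)`, where `⊕` becomes
  `+`), and `h = −ϖ̄ z + ⋯` is invertible because `ϖ` is a unit: so `[π]˜ = φ`.
* §2 ★★★ `isLTSeries_of_root` — **`[π] ∈ 𝔉_π`** (`[π] ≡ πz (mod deg 2)`, `[π] ≡ z^p (mod π)`);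
  `isLTRing_of_root` — `(ℤ_p, π, q = p)` satisfies the Lubin–Tate hypotheses; ★★★
  `formalGroupLaw_eq_ltF_of_root` — **`V̂ = F_{[π]}` IS the Lubin–Tate formal group of `[π]`** (by
  `LubinTate.eq_limit`: a formal group law admitting `f ∈ 𝔉_π` as an endomorphism is `F_f`;
  cf. `LubinTate.eq_ltF_of_compLeft_eq_compRight`), and `exists_isLTSeries_formalGroupLaw_eq_ltF` (packaged).
* §3 `exists_isUnit_sq_sub_mul_add_eq_zero` — the unit root exists when `p ∤ a` (Hensel at `T = a`).

This is de Shalit's Lemma II.1.10 («`Ê` is a relative Lubin–Tate group … of height 1 if `𝔭` is split»,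
with (24) `[ψ(𝔭)]^(t) = Λ(𝔭)t + … ≡ t^q mod 𝔓`) at a prime `𝔭` of a CM field `K` of DEGREE ONE over `p`
(`K_𝔭 = ℚ_p`, e.g. `K = ℚ(√−7)`, `p = 2`): there `ψ(𝔭) ∈ 𝔭` is the non-unit root of `T² − a_𝔭T + p`,
i.e. `ψ(𝔭) = π`; but the statement proved here needs NO complex multiplication — every ordinary curve over
`ℤ_p` has Lubin–Tate formal group for the uniformiser `p/ϖ` (Lubin–Tate 1965 §1).  For the measure lane of
cell `bsd-print-cf2` (seat `bsd-line-cf2c-w4` g12, brick B6 (i)): `[1]_{f′,[π]}` (`LubinTate.hom`) is then an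
integral isomorphism `V̂ ≅ F_{f′}` onto the lane's model `f′ = πX + X^q`, and Coates–Wiles values are
model-independent (`LubinTateIsomorphismDifferential`).  No summit statement is proved here.

## References
* [deShalit1987] E. de Shalit, *Iwasawa theory of elliptic curves with complex multiplication* (1987),
  Ch. II §1.10 Lemma and (24) (p. 39); Ch. I §1.1–1.2.
* [LubinTate1965] J. Lubin, J. Tate, *Formal complex multiplication in local fields*, Ann. of Math. 81
  (1965), §1 (4), Lemma 1, Thm. 1.
* [SilvermanAEC2009] J. H. Silverman, *The Arithmetic of Elliptic Curves*, 2nd ed. (2009), IV.2.3,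
  IV.3.2, IV.7, V.2.3.1 (b) (`φ² − aφ + p = 0`), A.1.2.
* [Honda1970] T. Honda, J. Math. Soc. Japan 22 (1970), §6.2 (Frobenius in `End(Ê ⊗ 𝔽_p)`).
-/

noncomputable section

open scoped Classical
open PowerSeries Literature.NumberTheory.EllipticCurves

namespace WeierstrassCurve

open scoped LaurentSeries

/-! ### §1. `[π] ≡ zᵖ (mod p)`: Frobenius in `End(Ṽ̂)` read on the formal point over `𝔽_p⸨z⸩` -/

section ModP

variable {p : ℕ} [hp : Fact p.Prime] (V : WeierstrassCurve ℤ_[p]) [hE : (V.map PadicInt.Coe.ringHom).IsElliptic]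
  [hEt : (V.map PadicInt.toZMod).IsElliptic]

omit hE hEt in
/-- `f(z) = f` (substituting the variable itself). [folklore] -/
private theorem subst_X_self {R : Type*} [CommRing R] (f : R⟦X⟧) : PowerSeries.subst (X : R⟦X⟧) f = f := by
  rw [← map_algebraMap_eq_subst_X, Algebra.algebraMap_self, PowerSeries.map_id]; rfl

omit hE hEt in
/-- `f(σ)(0) = 0` when `f(0) = 0 = σ(0)`. [folklore] -/
private theorem cc0 {R : Type*} [CommRing R] {σ f : R⟦X⟧} (hσ : constantCoeff σ = 0) (hf : constantCoeff f = 0) :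
    constantCoeff (PowerSeries.subst σ f) = 0 :=
  (Literature.RingTheory.FormalGroups.constantCoeff_subst_of_constantCoeff_eq_zero hσ f).trans hf

/-- ★★ **`[π] ≡ zᵖ (mod p)`** for `π = a − ϖ`, `ϖ ∈ ℤ_pˣ` a root of `T² − aT + p`, `a = p + 1 − #Ṽ(𝔽_p)`:
the reduction of (any integral lift `P` of) `[π] = exp_W(π log_W)` IS the Frobenius power series `zᵖ`.
Proof on the formal point `P(σ) ∈ Ṽ(𝔽_p⸨z⸩)` (`laurentPt`, injective, `P(F̃(σ,τ)) = P(σ) + P(τ)`):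
Manin's `P(z^{p²}) − a•P(zᵖ) + p•P(z) = O` together with `F̃([π]˜σ, [ϖ]˜σ) = [a]˜σ` and
`[π]˜ ∘ [ϖ]˜ = [p]˜` gives `P([π]˜(h)) = P(h(zᵖ))` for `h = F̃(zᵖ, ĩ([ϖ]˜))`, so `[π]˜ ∘ h = h ∘ zᵖ = zᵖ ∘ h`
and `h = −ϖ̄z + ⋯` is invertible. [cite: deShalit1987, Ch. II §1.10 (24)] [cite: SilvermanAEC2009, V.2.3.1 (b)] -/
theorem map_toZMod_eq_X_pow_of_root {ϖ : ℤ_[p]} (hϖ : IsUnit ϖ)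
    (hroot : ϖ ^ 2 - (Literature.NumberTheory.EllipticCurves.HasseManin.tr (V.map PadicInt.toZMod) : ℤ_[p]) * ϖ + p = 0)
    {P : ℤ_[p]⟦X⟧} (hP : P.map PadicInt.Coe.ringHom = (V.map PadicInt.Coe.ringHom).formalExp.subst
      (C (((Literature.NumberTheory.EllipticCurves.HasseManin.tr (V.map PadicInt.toZMod) : ℤ_[p]) - ϖ : ℤ_[p]) :
        ℚ_[p]) * (V.map PadicInt.Coe.ringHom).formalLog)) :
    P.map PadicInt.toZMod = (X : (ZMod p)⟦X⟧) ^ p := by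
  -- notation: `a`, `φ = zᵖ`, `Pt = [π]˜`, `Qt = [ϖ]˜`
  set a : ℤ := Literature.NumberTheory.EllipticCurves.HasseManin.tr (V.map PadicInt.toZMod) with ha
  have hp0 : p ≠ 0 := hp.out.ne_zero
  set φ : (ZMod p)⟦X⟧ := (X : (ZMod p)⟦X⟧) ^ p with hφ
  have hX0 : constantCoeff (X : (ZMod p)⟦X⟧) = 0 := constantCoeff_X
  have hφ0 : constantCoeff φ = 0 := constantCoeff_pow_prime hX0 hp0
  have hφφ0 : constantCoeff ((X : (ZMod p)⟦X⟧) ^ p ^ 2) = 0 := constantCoeff_pow_prime hX0 (pow_ne_zero 2 hp0)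
  have hφs : HasSubst φ := HasSubst.of_constantCoeff_zero' hφ0
  obtain ⟨Q, hQ⟩ := V.exists_map_eq_formalExp_subst_C_mul_formalLog ϖ
  have hπϖ : ((a : ℤ_[p]) - ϖ) * ϖ = (p : ℕ) := by
    have : ((a : ℤ_[p]) - ϖ) * ϖ = -(ϖ ^ 2 - (a : ℤ_[p]) * ϖ + p) + p := by ring
    rw [this, hroot, neg_zero, zero_add]
  have hsumc : ((a : ℤ_[p]) - ϖ) + ϖ = (a : ℤ_[p]) := sub_add_cancel _ _
  set Pt := P.map PadicInt.toZMod with hPt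
  set Qt := Q.map PadicInt.toZMod with hQt
  have hP0 : constantCoeff P = 0 := constantCoeff_eq_zero_of_map_eq hP
  have hQ0 : constantCoeff Q = 0 := constantCoeff_eq_zero_of_map_eq hQ
  have hPt0 : constantCoeff Pt = 0 := by rw [hPt, ← coeff_zero_eq_constantCoeff_apply, coeff_map,
    coeff_zero_eq_constantCoeff_apply, hP0, map_zero]
  have hQt0 : constantCoeff Qt = 0 := by rw [hQt, ← coeff_zero_eq_constantCoeff_apply, coeff_map,
    coeff_zero_eq_constantCoeff_apply, hQ0, map_zero]
  have hQts : HasSubst Qt := HasSubst.of_constantCoeff_zero' hQt0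
  -- reduction of a pair-substitution into `F`
  have hredF : ∀ {A B : ℤ_[p]⟦X⟧} (hA : constantCoeff A = 0) (hB : constantCoeff B = 0),
      PowerSeries.map PadicInt.toZMod (MvPowerSeries.subst ![A, B] V.formalGroupLaw) =
        MvPowerSeries.subst ![PowerSeries.map PadicInt.toZMod A, PowerSeries.map PadicInt.toZMod B]
          (V.map PadicInt.toZMod).formalGroupLaw := by
    intro A B hA hB
    exact map_subst_pair_formalGroupLaw V PadicInt.toZMod (σ := Unit) hA hB
  -- (E1) `[π]˜ ∈ End(F̃)`
  have hPend := map_subst_formalGroupLaw_of_map_eq hP PadicInt.toZMod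
  have hPadd := fun {σ τ : (ZMod p)⟦X⟧} (hσ : constantCoeff σ = 0) (hτ : constantCoeff τ = 0) =>
    V.subst_subst_pair_of_subst_formalGroupLaw PadicInt.toZMod hPt0 hPend hσ hτ
  -- (E3) `[π]˜ ∘ [ϖ]˜ = [p]˜`
  have hcomp : PowerSeries.subst Qt Pt = (V.map PadicInt.toZMod).formalMul p := by
    have hT : PowerSeries.map PadicInt.Coe.ringHom (V.formalMul p) = (V.map PadicInt.Coe.ringHom).formalExp.subst
        (C ((((a : ℤ_[p]) - ϖ) * ϖ : ℤ_[p]) : ℚ_[p]) * (V.map PadicInt.Coe.ringHom).formalLog) := by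
      haveI := V.isIntegral_map_coe
      rw [hπϖ, map_formalMul, PadicInt.coe_natCast]
      exact ((V.map PadicInt.Coe.ringHom).formalExp_subst_natCast_mul_formalLog p).symm
    have h := congrArg (PowerSeries.map PadicInt.toZMod) (subst_of_map_eq hP hQ hT)
    rwa [Literature.NumberTheory.EllipticCurves.powerSeries_map_subst (HasSubst.of_constantCoeff_zero' hQ0),
      map_formalMul] at h
  -- (E2) `F̃([π]˜, [ϖ]˜) = [a]˜`, read on points: `P([π]˜σ) + P([ϖ]˜σ) = a • P(σ)`
  have hsum : ∀ {σ : (ZMod p)⟦X⟧} (hσ : constantCoeff σ = 0),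
      (V.map PadicInt.toZMod).laurentPt (PowerSeries.subst σ Pt) (cc0 hσ hPt0) +
        (V.map PadicInt.toZMod).laurentPt (PowerSeries.subst σ Qt) (cc0 hσ hQt0) =
      a • (V.map PadicInt.toZMod).laurentPt σ hσ := by
    intro σ hσ
    by_cases ha0 : 0 ≤ a
    · -- the integral lift of `[a]` is `formalMul a`
      have hS : PowerSeries.map PadicInt.Coe.ringHom (V.formalMul a.toNat) =
          (V.map PadicInt.Coe.ringHom).formalExp.subst
          (C ((((a : ℤ_[p]) - ϖ) + ϖ : ℤ_[p]) : ℚ_[p]) * (V.map PadicInt.Coe.ringHom).formalLog) := by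
        haveI := V.isIntegral_map_coe
        rw [hsumc, map_formalMul, show ((a : ℤ_[p]) : ℚ_[p]) = ((a.toNat : ℕ) : ℚ_[p]) by
          rw [PadicInt.coe_intCast]; exact_mod_cast (Int.toNat_of_nonneg ha0).symm]
        exact ((V.map PadicInt.Coe.ringHom).formalExp_subst_natCast_mul_formalLog _).symm
      have h2 := congrArg (PowerSeries.map PadicInt.toZMod) (subst_pair_formalGroupLaw_of_map_eq hP hQ hS)
      rw [map_formalMul, hredF hP0 hQ0] at h2
      have h4 := congrArg (PowerSeries.subst σ) h2
      rw [subst_subst_pair hσ hPt0 hQt0] at h4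
      rw [← laurentPt_formalGroupLaw' V PadicInt.toZMod (hσ0 := cc0 hσ hPt0) (hτ0 := cc0 hσ hQt0),
        laurentPt_congr h4 _ (cc0 hσ ((V.map PadicInt.toZMod).constantCoeff_formalMul _)),
        laurentPt_formalMul' V PadicInt.toZMod _ hσ, ← natCast_zsmul, Int.toNat_of_nonneg ha0]
    · -- the integral lift of `[a]` is `i ∘ formalMul |a|`
      have hS : PowerSeries.map PadicInt.Coe.ringHom (V.formalNeg.subst (V.formalMul a.natAbs)) =
          (V.map PadicInt.Coe.ringHom).formalExp.subst
          (C ((((a : ℤ_[p]) - ϖ) + ϖ : ℤ_[p]) : ℚ_[p]) * (V.map PadicInt.Coe.ringHom).formalLog) := by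
        haveI := V.isIntegral_map_coe
        rw [hsumc, Literature.NumberTheory.EllipticCurves.powerSeries_map_subst (V.hasSubst_formalMul _),
          map_formalNeg, map_formalMul, show ((a : ℤ_[p]) : ℚ_[p]) = -((a.natAbs : ℕ) : ℚ_[p]) by
          rw [PadicInt.coe_intCast]; exact_mod_cast (by omega : a = -((a.natAbs : ℕ) : ℤ))]
        exact (V.map PadicInt.Coe.ringHom).formalNeg_subst_formalMul_eq _
      have h2 := congrArg (PowerSeries.map PadicInt.toZMod) (subst_pair_formalGroupLaw_of_map_eq hP hQ hS)
      rw [Literature.NumberTheory.EllipticCurves.powerSeries_map_subst (V.hasSubst_formalMul _), map_formalNeg,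
        map_formalMul, hredF hP0 hQ0] at h2
      have h4 := congrArg (PowerSeries.subst σ) h2
      rw [subst_subst_pair hσ hPt0 hQt0, subst_comp_subst_apply ((V.map PadicInt.toZMod).hasSubst_formalMul _)
        (HasSubst.of_constantCoeff_zero' hσ)] at h4
      have hm0 : constantCoeff (PowerSeries.subst σ ((V.map PadicInt.toZMod).formalMul a.natAbs)) = 0 :=
        cc0 hσ ((V.map PadicInt.toZMod).constantCoeff_formalMul _)
      rw [← laurentPt_formalGroupLaw' V PadicInt.toZMod (hσ0 := cc0 hσ hPt0) (hτ0 := cc0 hσ hQt0),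
        laurentPt_congr h4 _ (constantCoeff_formalNeg_subst hm0),
        ← neg_laurentPt hm0, laurentPt_formalMul' V PadicInt.toZMod _ hσ, ← natCast_zsmul, ← neg_zsmul]
      congr 1
      omega
  -- (E3) on points: `P([π]˜[ϖ]˜) = p • P(z)`
  have hcompPt : (V.map PadicInt.toZMod).laurentPt (PowerSeries.subst Qt Pt) (cc0 hQt0 hPt0) =
      (p : ℤ) • (V.map PadicInt.toZMod).laurentPt (X : (ZMod p)⟦X⟧) hX0 := by
    rw [laurentPt_congr hcomp _ ((V.map PadicInt.toZMod).constantCoeff_formalMul p), natCast_zsmul]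
    exact (laurentPt_congr (subst_X_self _).symm _ _).trans (laurentPt_formalMul' V PadicInt.toZMod p hX0)
  -- `P([π]˜ ĩ [ϖ]˜) = − P([π]˜[ϖ]˜)`
  have hiQ0 : constantCoeff ((V.map PadicInt.toZMod).formalNeg.subst Qt) = 0 := constantCoeff_formalNeg_subst hQt0
  have hPiQ : (V.map PadicInt.toZMod).laurentPt (PowerSeries.subst ((V.map PadicInt.toZMod).formalNeg.subst Qt) Pt)
      (cc0 hiQ0 hPt0) = -(V.map PadicInt.toZMod).laurentPt (PowerSeries.subst Qt Pt) (cc0 hQt0 hPt0) := by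
    rw [eq_neg_iff_add_eq_zero, add_comm,
      ← laurentPt_formalGroupLaw' V PadicInt.toZMod (hσ0 := cc0 hQt0 hPt0) (hτ0 := cc0 hiQ0 hPt0)]
    have h0 : MvPowerSeries.subst ![PowerSeries.subst Qt Pt,
        PowerSeries.subst ((V.map PadicInt.toZMod).formalNeg.subst Qt) Pt] (V.map PadicInt.toZMod).formalGroupLaw = 0 := by
      rw [← hPadd hQt0 hiQ0, formalGroupLaw_subst_pair_formalNeg hQt0, subst_zero_of_constantCoeff_zero hPt0]
    rw [laurentPt_congr h0 _ (map_zero _), laurentPt_zero]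
  -- the invertible series `h = F̃(zᵖ, ĩ[ϖ]˜) = −ϖ̄ z + ⋯`
  set h : (ZMod p)⟦X⟧ := MvPowerSeries.subst ![φ, (V.map PadicInt.toZMod).formalNeg.subst Qt]
    (V.map PadicInt.toZMod).formalGroupLaw with hhdef
  have hh0 : constantCoeff h = 0 := constantCoeff_formalGroupLaw_subst_pair V PadicInt.toZMod hφ0 hiQ0
  have hhs : HasSubst h := HasSubst.of_constantCoeff_zero' hh0
  have hh1 : IsUnit (coeff 1 h) := by
    have hXp0 : constantCoeff ((X : ℤ_[p]⟦X⟧) ^ p) = 0 := by rw [map_pow, constantCoeff_X, zero_pow hp0]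
    have hiQZ : constantCoeff (V.formalNeg.subst Q) = 0 := by
      rw [Literature.RingTheory.FormalGroups.constantCoeff_subst_of_constantCoeff_eq_zero hQ0, constantCoeff_formalNeg]
    have hm := hredF hXp0 hiQZ
    rw [map_pow, map_X, Literature.NumberTheory.EllipticCurves.powerSeries_map_subst
      (HasSubst.of_constantCoeff_zero' hQ0), map_formalNeg] at hm
    have hm1 := congrArg (coeff 1) hm
    rw [coeff_map, coeff_one_subst_X_pow_formalNeg_of_map_eq hQ, map_neg] at hm1
    rw [hhdef, hφ, hQt, ← hm1, IsUnit.neg_iff]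
    exact hϖ.map _
  -- KEY: `P([π]˜(h)) = P(h(zᵖ))`
  have hPh0 : constantCoeff (PowerSeries.subst h Pt) = 0 := cc0 hh0 hPt0
  have hhφ0 : constantCoeff (PowerSeries.subst φ h) = 0 := cc0 hφ0 hh0
  have key : (V.map PadicInt.toZMod).laurentPt (PowerSeries.subst h Pt) hPh0 =
      (V.map PadicInt.toZMod).laurentPt (PowerSeries.subst φ h) hhφ0 := by
    -- left: `P([π]˜φ) + P([π]˜ ĩ[ϖ]˜) = P([π]˜φ) − p•P(z)`
    have hL : PowerSeries.subst h Pt = MvPowerSeries.subst ![PowerSeries.subst φ Pt,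
        PowerSeries.subst ((V.map PadicInt.toZMod).formalNeg.subst Qt) Pt] (V.map PadicInt.toZMod).formalGroupLaw := by
      rw [hhdef]; exact hPadd hφ0 hiQ0
    -- right: `P(z^{p²}) − P([ϖ]˜φ)`
    have hR : PowerSeries.subst φ h = MvPowerSeries.subst ![(X : (ZMod p)⟦X⟧) ^ p ^ 2,
        (V.map PadicInt.toZMod).formalNeg.subst (PowerSeries.subst φ Qt)] (V.map PadicInt.toZMod).formalGroupLaw := by
      rw [hhdef, subst_subst_pair hφ0 hφ0 hiQ0, subst_comp_subst_apply hQts hφs, hφ, subst_pow hφs, subst_X hφs,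
        ← pow_mul, sq]
    have hQφ0 : constantCoeff (PowerSeries.subst φ Qt) = 0 := cc0 hφ0 hQt0
    have hPφ0 : constantCoeff (PowerSeries.subst φ Pt) = 0 := cc0 hφ0 hPt0
    rw [laurentPt_congr hL _ (constantCoeff_formalGroupLaw_subst_pair V PadicInt.toZMod hPφ0 (cc0 hiQ0 hPt0)),
      laurentPt_congr hR _ (constantCoeff_formalGroupLaw_subst_pair V PadicInt.toZMod hφφ0
        (constantCoeff_formalNeg_subst hQφ0)),
      laurentPt_formalGroupLaw' V PadicInt.toZMod (hσ0 := hPφ0) (hτ0 := cc0 hiQ0 hPt0),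
      laurentPt_formalGroupLaw' V PadicInt.toZMod (hσ0 := hφφ0) (hτ0 := constantCoeff_formalNeg_subst hQφ0),
      hPiQ, hcompPt, ← neg_laurentPt hQφ0]
    -- Manin: `P(z^{p²}) = a • P(zᵖ) − p • P(z)`
    have hrel := (V.map PadicInt.toZMod).frob_relation_laurentPt
    rw [← ha, sub_add_eq_add_sub, sub_eq_zero] at hrel
    have hM : (V.map PadicInt.toZMod).laurentPt ((X : (ZMod p)⟦X⟧) ^ p ^ 2) hφφ0 =
        a • (V.map PadicInt.toZMod).laurentPt φ hφ0 - (p : ℤ) • (V.map PadicInt.toZMod).laurentPt X hX0 := by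
      rw [eq_sub_iff_add_eq]; exact hrel
    rw [hM, ← hsum hφ0]
    abel
  have key2 : PowerSeries.subst h Pt = PowerSeries.subst h φ := by
    rw [laurentPt_injective hPh0 hhφ0 key, hφ, subst_X_pow_eq_pow_zmod, subst_pow hhs, subst_X hhs]
  -- cancel the invertible `h`
  have hg := HasSubst.substInvOfIsUnit h hh1
  calc Pt = PowerSeries.subst (PowerSeries.subst (h.substInvOfIsUnit hh1) h) Pt := by
        rw [subst_substInvOfIsUnit_right h hh0 hh1, subst_X_self]
    _ = PowerSeries.subst (h.substInvOfIsUnit hh1) (PowerSeries.subst h Pt) := (subst_comp_subst_apply hhs hg _).symm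
    _ = PowerSeries.subst (h.substInvOfIsUnit hh1) (PowerSeries.subst h φ) := by rw [key2]
    _ = PowerSeries.subst (PowerSeries.subst (h.substInvOfIsUnit hh1) h) φ := subst_comp_subst_apply hhs hg _
    _ = φ := by rw [subst_substInvOfIsUnit_right h hh0 hh1, subst_X_self]

end ModP

/-! ### §2. `[π] ∈ 𝔉_π` and `V̂ = F_{[π]}` is the Lubin–Tate group of `[π]` over `ℤ_p` -/

section LubinTate

open Literature.NumberTheory.GaloisRepresentations.LubinTate

variable {p : ℕ} [hp : Fact p.Prime] (V : WeierstrassCurve ℤ_[p]) [hE : (V.map PadicInt.Coe.ringHom).IsElliptic]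
  [hEt : (V.map PadicInt.toZMod).IsElliptic]

omit hE hEt in
/-- `π := a − ϖ` times the unit root `ϖ` is `p`. [cite: deShalit1987, Ch. II §1.10] -/
theorem sub_mul_eq_natCast_of_root {a ϖ : ℤ_[p]} (hroot : ϖ ^ 2 - a * ϖ + p = 0) : (a - ϖ) * ϖ = (p : ℕ) := by
  have : (a - ϖ) * ϖ = -(ϖ ^ 2 - a * ϖ + p) + p := by ring
  rw [this, hroot, neg_zero, zero_add]

omit hE hEt in
/-- `π = a − ϖ` is a NON-unit of `ℤ_p` (`‖π‖ = ‖p‖ < 1`) when `ϖ` is a unit root of `T² − aT + p`.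
[cite: deShalit1987, Ch. II §1.10] -/
theorem norm_sub_lt_one_of_root {a ϖ : ℤ_[p]} (hϖ : IsUnit ϖ) (hroot : ϖ ^ 2 - a * ϖ + p = 0) : ‖a - ϖ‖ < 1 := by
  have h := congrArg (fun x : ℤ_[p] => ‖x‖) (sub_mul_eq_natCast_of_root hroot)
  simp only [norm_mul, PadicInt.isUnit_iff.mp hϖ, mul_one] at h
  rw [h, PadicInt.norm_p]
  exact inv_lt_one_of_one_lt₀ (by exact_mod_cast hp.out.one_lt)

omit hE hEt in
/-- **`(ℤ_p, π, q = p)` satisfies the Lubin–Tate hypotheses** for `π = a − ϖ` (`πϖ = p`, `ϖ ∈ ℤ_pˣ`): `π` is a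
non-zero-divisor, `1 − π^m` are units, `p ∈ πℤ_p`, and `x^p ≡ x (mod π)` (Fermat in `ℤ_p/p = 𝔽_p`, and `π ∣ p`).
[cite: LubinTate1965, §1] [cite: deShalit1987, Ch. I §1.1] -/
theorem isLTRing_of_root {a ϖ : ℤ_[p]} (hϖ : IsUnit ϖ) (hroot : ϖ ^ 2 - a * ϖ + p = 0) : IsLTRing (a - ϖ) p := by
  have hπϖ := sub_mul_eq_natCast_of_root hroot
  have hπdvd : (a - ϖ) ∣ (p : ℤ_[p]) := ⟨ϖ, hπϖ.symm⟩
  have hπ0 : a - ϖ ≠ 0 := fun h => by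
    rw [h, zero_mul] at hπϖ
    exact hp.out.ne_zero (by exact_mod_cast hπϖ.symm)
  refine ⟨fun x hx => (mul_eq_zero.mp hx).resolve_left hπ0, fun m hm => ?_, ⟨p, 1, hp.out, (pow_one p).symm,
    Ideal.mem_span_singleton.mpr hπdvd⟩, fun x => hπdvd.trans ?_⟩
  · apply IsLocalRing.isUnit_one_sub_self_of_mem_nonunits
    rw [PadicInt.mem_nonunits, norm_pow]
    exact pow_lt_one₀ (norm_nonneg _) (norm_sub_lt_one_of_root hϖ hroot) hm.ne'
  · rw [← Ideal.mem_span_singleton, ← PadicInt.maximalIdeal_eq_span_p, ← PadicInt.ker_toZMod, RingHom.mem_ker,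
      map_sub, map_pow, ZMod.pow_card, sub_self]

/-- ★★★ **`[π] ∈ 𝔉_π`**: the integral series `[π] = exp_W(π·log_W)`, `π = a − ϖ` (`a = p + 1 − #Ṽ(𝔽_p)`,
`ϖ ∈ ℤ_pˣ`, `ϖ² − aϖ + p = 0`), satisfies `[π](0) = 0`, `[π] ≡ πz (mod deg 2)` and `[π] ≡ z^p (mod π)` — de
Shalit's (24) `[ψ(𝔭)]^(t) = Λ(𝔭)t + … ≡ t^q mod 𝔓` for a prime of degree one. [cite: deShalit1987, Ch. II §1.10 (24)]
[cite: LubinTate1965, §1] -/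
theorem isLTSeries_of_root {ϖ : ℤ_[p]} (hϖ : IsUnit ϖ)
    (hroot : ϖ ^ 2 - (Literature.NumberTheory.EllipticCurves.HasseManin.tr (V.map PadicInt.toZMod) : ℤ_[p]) * ϖ + p = 0)
    {P : ℤ_[p]⟦X⟧} (hP : P.map PadicInt.Coe.ringHom = (V.map PadicInt.Coe.ringHom).formalExp.subst
      (C (((Literature.NumberTheory.EllipticCurves.HasseManin.tr (V.map PadicInt.toZMod) : ℤ_[p]) - ϖ : ℤ_[p]) :
        ℚ_[p]) * (V.map PadicInt.Coe.ringHom).formalLog)) :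
    IsLTSeries ((Literature.NumberTheory.EllipticCurves.HasseManin.tr (V.map PadicInt.toZMod) : ℤ_[p]) - ϖ) p P := by
  have hred := V.map_toZMod_eq_X_pow_of_root hϖ hroot hP
  refine ⟨constantCoeff_eq_zero_of_map_eq hP, coeff_one_eq_of_map_eq hP, fun n => ?_⟩
  refine (Dvd.intro ϖ (sub_mul_eq_natCast_of_root hroot)).trans ?_
  rw [← Ideal.mem_span_singleton, ← PadicInt.maximalIdeal_eq_span_p, ← PadicInt.ker_toZMod, RingHom.mem_ker,
    map_sub, ← coeff_map, hred, coeff_X_pow]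
  split_ifs <;> simp

omit hEt in
/-- `F ≡ z₁ + z₂ (mod deg 2)` for the formal group law of `V/ℤ_p` (transfer of the linear coefficients of
`F_W`, `W = V ⊗ ℚ_p`). [cite: SilvermanAEC2009, IV.1.1] -/
theorem coeff_formalGroupLaw_single (i : Fin 2) : MvPowerSeries.coeff (Finsupp.single i 1) V.formalGroupLaw = 1 := by
  haveI := V.isIntegral_map_coe
  apply PadicInt.ext
  rw [PadicInt.coe_one, show ((MvPowerSeries.coeff (Finsupp.single i 1) V.formalGroupLaw : ℤ_[p]) : ℚ_[p]) =
    MvPowerSeries.coeff (Finsupp.single i 1) (V.map PadicInt.Coe.ringHom).formalGroupLaw by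
      rw [← map_formalGroupLaw, MvPowerSeries.coeff_map]; rfl]
  fin_cases i
  · exact (V.map PadicInt.Coe.ringHom).coeff_single_zero_formalGroupLaw
  · exact (V.map PadicInt.Coe.ringHom).coeff_single_one_formalGroupLaw

/-- ★★★ **The formal group of an ordinary elliptic curve over `ℤ_p` IS the Lubin–Tate group `F_{[π]}`**:
`V.formalGroupLaw = ltF` for the Lubin–Tate series `[π]`, `π = a − ϖ = p/ϖ` — a formal group law admitting
`f ∈ 𝔉_π` as an endomorphism is `F_f` (`LubinTate.eq_limit` / `eq_ltF_of_compLeft_eq_compRight`), and `[π]` is an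
endomorphism of `V̂` (`subst_formalGroupLaw_of_map_eq`).  De Shalit II.1.10: «`Ê` is a relative Lubin–Tate group
… of height 1 if `𝔭` is split», here at a prime of degree one and with no CM hypothesis. [cite: deShalit1987, Ch. II §1.10 Lemma]
[cite: LubinTate1965, §1 Thm. 1] -/
theorem formalGroupLaw_eq_ltF_of_root {ϖ : ℤ_[p]} (hϖ : IsUnit ϖ)
    (hroot : ϖ ^ 2 - (Literature.NumberTheory.EllipticCurves.HasseManin.tr (V.map PadicInt.toZMod) : ℤ_[p]) * ϖ + p = 0)
    {P : ℤ_[p]⟦X⟧} (hP : P.map PadicInt.Coe.ringHom = (V.map PadicInt.Coe.ringHom).formalExp.subst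
      (C (((Literature.NumberTheory.EllipticCurves.HasseManin.tr (V.map PadicInt.toZMod) : ℤ_[p]) - ϖ : ℤ_[p]) :
        ℚ_[p]) * (V.map PadicInt.Coe.ringHom).formalLog)) :
    V.formalGroupLaw = ltF (isLTRing_of_root (p := p) hϖ hroot) (V.isLTSeries_of_root hϖ hroot hP) := by
  refine eq_limit _ _ _ V.constantCoeff_formalGroupLaw (fun i => V.coeff_formalGroupLaw_single i) ?_
  rw [compLeft, compRight, PowerSeries.subst, ← PowerSeries.subst, subst_formalGroupLaw_of_map_eq hP]
  congr 1
  funext i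
  fin_cases i <;> rfl

/-- **Packaged**: for `V/ℤ_p` with elliptic fibres and a unit root `ϖ` of `T² − aT + p` there is a Lubin–Tate
series `f ∈ 𝔉_{a − ϖ}` over `ℤ_p` — namely `[a − ϖ] = exp_W((a − ϖ) log_W)` — with `V̂ = F_f`.
[cite: deShalit1987, Ch. II §1.10 Lemma] [cite: LubinTate1965, §1 Thm. 1] -/
theorem exists_isLTSeries_formalGroupLaw_eq_ltF {ϖ : ℤ_[p]} (hϖ : IsUnit ϖ)
    (hroot : ϖ ^ 2 - (Literature.NumberTheory.EllipticCurves.HasseManin.tr (V.map PadicInt.toZMod) : ℤ_[p]) * ϖ + p = 0) :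
    ∃ P : ℤ_[p]⟦X⟧, P.map PadicInt.Coe.ringHom = (V.map PadicInt.Coe.ringHom).formalExp.subst
      (C (((Literature.NumberTheory.EllipticCurves.HasseManin.tr (V.map PadicInt.toZMod) : ℤ_[p]) - ϖ : ℤ_[p]) :
        ℚ_[p]) * (V.map PadicInt.Coe.ringHom).formalLog) ∧
      ∃ hf : IsLTSeries ((Literature.NumberTheory.EllipticCurves.HasseManin.tr (V.map PadicInt.toZMod) : ℤ_[p]) - ϖ) p P,
        V.formalGroupLaw = ltF (isLTRing_of_root (p := p) hϖ hroot) hf := by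
  obtain ⟨P, hP⟩ := V.exists_map_eq_formalExp_subst_C_mul_formalLog
    ((Literature.NumberTheory.EllipticCurves.HasseManin.tr (V.map PadicInt.toZMod) : ℤ_[p]) - ϖ)
  exact ⟨P, hP, V.isLTSeries_of_root hϖ hroot hP, V.formalGroupLaw_eq_ltF_of_root hϖ hroot hP⟩

end LubinTate

/-! ### §3. Ordinary reduction supplies the unit root (Hensel) -/

section Hensel

variable {p : ℕ} [hp : Fact p.Prime]

/-- **The unit root of Frobenius**: if `p ∤ a` (ORDINARY reduction when `a = p + 1 − #Ṽ(𝔽_p)`), then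
`T² − aT + p` has a root `ϖ ∈ ℤ_pˣ` (Hensel's lemma at `T = a`: `f(a) = p`, `f′(a) = a` a unit); the other root
`a − ϖ = p/ϖ` is then a uniformiser. [cite: SilvermanAEC2009, V.2.3.1 (b), IV.3.2] [cite: deShalit1987, Ch. II §1.10] -/
theorem exists_isUnit_sq_sub_mul_add_eq_zero {a : ℤ_[p]} (ha : IsUnit a) :
    ∃ ϖ : ℤ_[p], IsUnit ϖ ∧ ϖ ^ 2 - a * ϖ + p = 0 := by
  set F : Polynomial ℤ_[p] := Polynomial.X ^ 2 - Polynomial.C a * Polynomial.X + Polynomial.C (p : ℤ_[p]) with hF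
  have hFa : F.aeval a = (p : ℤ_[p]) := by simp [hF, sq]
  have hF' : F.derivative = Polynomial.C (2 : ℤ_[p]) * Polynomial.X - Polynomial.C a := by
    simp only [hF, Polynomial.derivative_add, Polynomial.derivative_sub, Polynomial.derivative_X_pow,
      Polynomial.derivative_mul, Polynomial.derivative_C, Polynomial.derivative_X, zero_mul, zero_add, mul_one,
      Nat.cast_ofNat]
    ring
  have hF'a : F.derivative.aeval a = a := by
    rw [hF']; simp; ring
  have ha1 : ‖a‖ = 1 := PadicInt.isUnit_iff.mp ha
  have hnorm : ‖F.aeval a‖ < ‖F.derivative.aeval a‖ ^ 2 := by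
    rw [hFa, hF'a, ha1, one_pow, PadicInt.norm_p]
    exact inv_lt_one_of_one_lt₀ (by exact_mod_cast hp.out.one_lt)
  obtain ⟨ϖ, hϖ0, hϖa, -, -⟩ := hensels_lemma hnorm
  refine ⟨ϖ, ?_, ?_⟩
  · rw [PadicInt.isUnit_iff]
    rw [hF'a, ha1] at hϖa
    have h := norm_sub_norm_le ϖ a  -- ‖ϖ‖ - ‖a‖ ≤ ‖ϖ - a‖
    have h' := norm_sub_norm_le a ϖ
    rw [norm_sub_rev] at h'
    have hle : ‖ϖ‖ ≤ 1 := PadicInt.norm_le_one ϖ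
    -- ultrametric: ‖ϖ‖ = ‖a + (ϖ - a)‖ = 1 since ‖ϖ - a‖ < 1 = ‖a‖
    have : ϖ = a + (ϖ - a) := by ring
    rw [this]
    rw [PadicInt.norm_add_eq_max_of_ne (by rw [ha1]; exact hϖa.ne'), ha1, max_eq_left hϖa.le]
  · simpa [hF, sq] using hϖ0

end Hensel

end WeierstrassCurve
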